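import Summits.KontsevichZagierPeriods.KontsevichZagierPeriods.Theorems.SoloInformedNonintGlobal
import Summits.KontsevichZagierPeriods.KontsevichZagierPeriods.Theorems.SoloInformedAnDropCurve
import Summits.KontsevichZagierPeriods.KontsevichZagierPeriods.Theorems.SoloInformedAlgReduce
import Summits.KontsevichZagierPeriods.KontsevichZagierPeriods.Theorems.SoloInformedAlgFiniteZeros
import HarnessLib

/-!
# The special set of a planar presentation problem

Solo programme `solo-KontsevichZagierPeriods-informed`, session s111, kernel project PRES-RAT(2),
step (δ-2).  Three finiteness / algebraicity facts feeding the global step of the presentation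
theorem for rational integrands on `ℚ`-semialgebraic plane domains:

* **SING-FINITE** (`soloInformed_finite_singPts_of_squarefree`): a squarefree `C ∈ K[x, y]`
  has finitely many real singular points `C = ∂₀C = ∂₁C = 0` (Bézout against a cofactor or a
  partial derivative, factor by factor);
* **FRONTIER-SIGN** (`soloInformed_exists_frontier_subset_zeroSet`): the frontier of a
  `ℚ`-semialgebraic set lies on the zero set of a nonzero `ℚ`-polynomial (the product of the
  nonzero polynomials of a sign description: off it the sign vector is locally constant);
* the **special set** `Σ(F, D, Ω) = closure Ω ∩ Z(F) ∩ (Sing F ∪ Z(D))` is `ℚ`-semialgebraic,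
  finite when `Sing F` and the polar set `Z(D) ∩ closure Ω` are, and then consists of points
  with coordinates in any real-root-closed `K ⊆ ℚ̄ ∩ ℝ`.

References: Bochnak–Coste–Roy, *Real Algebraic Geometry* (1998), §2.2; Kontsevich–Zagier,
*Periods* (2001), §1.2.
-/

noncomputable section

open scoped BigOperators Topology
open MeasureTheory Set Filter Metric
open Literature.NumberTheory.Transcendental Literature.NumberTheory.Transcendental.KZ
open Literature.ModelTheory.ExponentialFields (IsSemialgebraic)

namespace Summit.KontsevichZagierPeriods.KontsevichZagierPeriods.Theorems

variable {K : Type*} [Field K] [Algebra K ℝ]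

/-! ### Singular points -/

/-- The real singular points of `Z(C)` as a subset of `ℝ²` (function form). [this work] -/
def soloInformedSingPts (C : MvPolynomial (Fin 2) K) : Set (Fin 2 → ℝ) :=
  {x | (MvPolynomial.aeval x C : ℝ) = 0 ∧ (MvPolynomial.aeval x (MvPolynomial.pderiv 0 C) : ℝ) = 0 ∧
    (MvPolynomial.aeval x (MvPolynomial.pderiv 1 C) : ℝ) = 0}

/-- Membership in the singular-point set. -/
theorem soloInformed_mem_singPts (C : MvPolynomial (Fin 2) K) (x : Fin 2 → ℝ) :
    x ∈ soloInformedSingPts C ↔ (MvPolynomial.aeval x C : ℝ) = 0 ∧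
      (MvPolynomial.aeval x (MvPolynomial.pderiv 0 C) : ℝ) = 0 ∧
      (MvPolynomial.aeval x (MvPolynomial.pderiv 1 C) : ℝ) = 0 := Iff.rfl

/-- The singular set (pair form) is the preimage of the singular-point set. -/
theorem soloInformed_singSet_eq_preimage_singPts (C : MvPolynomial (Fin 2) K) :
    soloInformedSingSet C = (fun q : ℝ × ℝ => (![q.1, q.2] : Fin 2 → ℝ)) ⁻¹' soloInformedSingPts C :=
  rfl

/-- Finiteness transfers from the function form to the pair form. -/
theorem soloInformed_singSet_finite_of_singPts {C : MvPolynomial (Fin 2) K}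
    (h : (soloInformedSingPts C).Finite) : (soloInformedSingSet C).Finite := by
  rw [soloInformed_singSet_eq_preimage_singPts]
  refine h.preimage fun p _ q _ hpq => ?_
  have h0 := congr_fun hpq 0
  have h1 := congr_fun hpq 1
  simp only [Matrix.cons_val_zero, Matrix.cons_val_one] at h0 h1
  exact Prod.ext h0 h1

/-- Finiteness transfers from the pair form to the function form. -/
theorem soloInformed_singPts_finite_of_singSet {C : MvPolynomial (Fin 2) K}
    (h : (soloInformedSingSet C).Finite) : (soloInformedSingPts C).Finite := by
  have heta : ∀ w : Fin 2 → ℝ, ![w 0, w 1] = w := fun w => by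
    funext i; fin_cases i <;> rfl
  have hsub : soloInformedSingPts C ⊆ (fun w : Fin 2 → ℝ => (w 0, w 1)) ⁻¹' soloInformedSingSet C := by
    intro w hw
    rw [mem_preimage, soloInformed_singSet_eq_preimage_singPts, mem_preimage, heta]
    exact hw
  refine (h.preimage fun v _ w _ hvw => ?_).subset hsub
  rw [← heta v, ← heta w]
  simp only [Prod.mk.injEq] at hvw
  rw [hvw.1, hvw.2]

/-- A unit of `K[x, y]` has no real zeros. -/
theorem soloInformed_aeval_ne_zero_of_isUnit {u : MvPolynomial (Fin 2) K} (hu : IsUnit u)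
    (x : Fin 2 → ℝ) : (MvPolynomial.aeval x u : ℝ) ≠ 0 :=
  (hu.map (MvPolynomial.aeval x)).ne_zero

/-- **SING-FINITE.**  A squarefree polynomial in two variables over `K ⊆ ℝ` has finitely many
real singular points.  Induction over an irreducible factorisation `C = q · a`: a singular
point of `Z(C)` on `Z(q)` lies on `Z(q) ∩ Z(a)` or on `Z(q) ∩ Z(∂ᵢ q)` (both finite by
Bézout, `q ∤ a` by squarefreeness, `q ∤ ∂ᵢ q` by degree), and one off `Z(q)` is a singular
point of `Z(a)`. [cite: BochnakCosteRoy1998, §2.2] -/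
theorem soloInformed_finite_singPts_of_squarefree {C : MvPolynomial (Fin 2) K}
    (hC : Squarefree C) : (soloInformedSingPts C).Finite := by
  have hC0 : C ≠ 0 := hC.ne_zero
  induction C using WfDvdMonoid.induction_on_irreducible with
  | zero => exact (hC0 rfl).elim
  | unit u hu =>
    refine (Set.finite_empty).subset fun x hx => ?_
    exact soloInformed_aeval_ne_zero_of_isUnit hu x hx.1
  | mul a q ha hq ih =>
    have hqa : ¬ q ∣ a := soloInformed_not_dvd_cofactor_of_squarefree hC hq rfl
    have ha' : Squarefree a := fun d hd => hC d (dvd_mul_of_dvd_right hd q)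
    have iha := ih ha' ha
    have hZa : ({x : Fin 2 → ℝ | (MvPolynomial.aeval x q : ℝ) = 0 ∧
        (MvPolynomial.aeval x a : ℝ) = 0}).Finite := soloInformed_finite_commonZeros hq hqa
    -- the part of `Sing(q a)` on `Z(q)` off `Z(a)`
    have hZq : ({x : Fin 2 → ℝ | (MvPolynomial.aeval x q : ℝ) = 0 ∧
        (MvPolynomial.aeval x (MvPolynomial.pderiv 0 q) : ℝ) = 0 ∧
        (MvPolynomial.aeval x (MvPolynomial.pderiv 1 q) : ℝ) = 0}).Finite := by
      by_cases hex : ∃ x : Fin 2 → ℝ, (MvPolynomial.aeval x q : ℝ) = 0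
      · obtain ⟨x₀, hx₀⟩ := hex
        obtain ⟨i, hi⟩ :=
          soloInformed_exists_pderiv_ne_zero (soloInformed_totalDegree_ne_zero_of_zero hq hx₀)
        refine (soloInformed_finite_commonZeros hq (soloInformed_not_dvd_pderiv_self hi)).subset
          fun x hx => ⟨hx.1, ?_⟩
        fin_cases i
        · exact hx.2.1
        · exact hx.2.2
      · exact (Set.finite_empty).subset fun x hx => hex ⟨x, hx.1⟩
    refine ((hZa.union hZq).union iha).subset fun x hx => ?_
    obtain ⟨h0, h1, h2⟩ := hx
    simp only [map_mul, MvPolynomial.pderiv_mul, map_add] at h0 h1 h2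
    by_cases hqx : (MvPolynomial.aeval x q : ℝ) = 0
    · by_cases hax : (MvPolynomial.aeval x a : ℝ) = 0
      · exact Or.inl (Or.inl ⟨hqx, hax⟩)
      · refine Or.inl (Or.inr ⟨hqx, ?_, ?_⟩)
        · rw [hqx, zero_mul, add_zero] at h1
          exact (mul_eq_zero.1 h1).resolve_right hax
        · rw [hqx, zero_mul, add_zero] at h2
          exact (mul_eq_zero.1 h2).resolve_right hax
    · have hax : (MvPolynomial.aeval x a : ℝ) = 0 := (mul_eq_zero.1 h0).resolve_left hqx
      refine Or.inr ⟨hax, ?_, ?_⟩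
      · rw [hax, mul_zero, zero_add] at h1
        exact (mul_eq_zero.1 h1).resolve_left hqx
      · rw [hax, mul_zero, zero_add] at h2
        exact (mul_eq_zero.1 h2).resolve_left hqx

/-- SING-FINITE in pair form. -/
theorem soloInformed_singSet_finite_of_squarefree {C : MvPolynomial (Fin 2) K}
    (hC : Squarefree C) : (soloInformedSingSet C).Finite :=
  soloInformed_singSet_finite_of_singPts (soloInformed_finite_singPts_of_squarefree hC)

/-! ### FRONTIER-SIGN -/

/-- **FRONTIER-SIGN.**  The frontier of a `ℚ`-semialgebraic set lies on the zero set of a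
nonzero polynomial with rational coefficients: writing `S = {x | sign-vector of Q at x ∈ T}`,
take the product of the nonzero members of `Q`; off its zero set every member of `Q` has
locally constant sign, so the point is interior to `S` or to its complement.
[cite: BochnakCosteRoy1998, §2.2] -/
theorem soloInformed_exists_frontier_subset_zeroSet {n : ℕ} {S : Set (Fin n → ℝ)}
    (hS : IsSemialgebraic ℚ S) :
    ∃ G : MvPolynomial (Fin n) ℚ, G ≠ 0 ∧
      frontier S ⊆ {x | (MvPolynomial.aeval x G : ℝ) = 0} := by
  classical
  obtain ⟨Q, T, hST⟩ := hS.exists_eq_setOf_signVec_mem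
  refine ⟨∏ q ∈ Q.filter (· ≠ 0), q, ?_, ?_⟩
  · exact Finset.prod_ne_zero_iff.2 fun q hq => (Finset.mem_filter.1 hq).2
  · intro x hx
    by_contra hG
    have hne : ∀ q ∈ Q, q ≠ 0 → (MvPolynomial.aeval x q : ℝ) ≠ 0 := by
      intro q hq hq0 h
      refine hG ?_
      rw [mem_setOf_eq, map_prod]
      exact Finset.prod_eq_zero (Finset.mem_filter.2 ⟨hq, hq0⟩) h
    -- the sign vector is locally constant at `x`
    have hev : ∀ᶠ y in 𝓝 x, ∀ q ∈ Q,
        SignType.sign (MvPolynomial.aeval y q : ℝ) = SignType.sign (MvPolynomial.aeval x q : ℝ) := by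
      refine (Filter.eventually_all_finset Q).2 fun q hq => ?_
      by_cases hq0 : q = 0
      · exact Filter.Eventually.of_forall fun y => by simp [hq0]
      have hc : ContinuousAt (fun y : Fin n → ℝ => (MvPolynomial.aeval y q : ℝ)) x :=
        (soloInformed_continuous_aevalK q).continuousAt
      rcases lt_or_gt_of_ne (hne q hq hq0) with h | h
      · filter_upwards [hc.eventually_lt continuousAt_const h] with y hy
        rw [sign_neg hy, sign_neg h]
      · filter_upwards [continuousAt_const.eventually_lt hc h] with y hy
        rw [sign_pos hy, sign_pos h]
    have hiff : ∀ᶠ y in 𝓝 x, y ∈ S ↔ x ∈ S := by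
      filter_upwards [hev] with y hy
      rw [hST, mem_setOf_eq, mem_setOf_eq]
      have hfun : (fun q : Q => SignType.sign (MvPolynomial.aeval y (q : MvPolynomial (Fin n) ℚ) : ℝ))
          = fun q : Q => SignType.sign (MvPolynomial.aeval x (q : MvPolynomial (Fin n) ℚ) : ℝ) :=
        funext fun q => hy q q.2
      rw [hfun]
    rw [frontier, Set.mem_sdiff] at hx
    by_cases hxS : x ∈ S
    · exact hx.2 (mem_interior_iff_mem_nhds.2 (hiff.mono fun y hy => hy.2 hxS))
    · have hfreq := mem_closure_iff_frequently.1 hx.1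
      obtain ⟨y, hyS, hy⟩ := (hfreq.and_eventually hiff).exists
      exact hxS (hy.1 hyS)

/-- FRONTIER-SIGN for a set and its interior simultaneously. -/
theorem soloInformed_exists_frontier_interior_subset_zeroSet {n : ℕ} {S : Set (Fin n → ℝ)}
    (hS : IsSemialgebraic ℚ S) :
    ∃ G : MvPolynomial (Fin n) ℚ, G ≠ 0 ∧
      frontier S ⊆ {x | (MvPolynomial.aeval x G : ℝ) = 0} ∧
      frontier (interior S) ⊆ {x | (MvPolynomial.aeval x G : ℝ) = 0} := by
  obtain ⟨G, hG, h⟩ := soloInformed_exists_frontier_subset_zeroSet hS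
  exact ⟨G, hG, h, frontier_interior_subset.trans h⟩

/-! ### The special set -/

/-- The zero set of a `K`-polynomial (`K ⊆ ℚ̄ ∩ ℝ`) is `ℚ`-semialgebraic. -/
theorem soloInformed_isSemialgebraic_zeroSetK_univ {n : ℕ}
    (hK : ∀ c : K, IsAlgebraic ℚ (algebraMap K ℝ c)) (Q : MvPolynomial (Fin n) K) :
    IsSemialgebraic ℚ {x : Fin n → ℝ | (MvPolynomial.aeval x Q : ℝ) = 0} := by
  have hu : IsSemialgebraic ℚ (univ : Set (Fin n → ℝ)) :=
    Literature.ModelTheory.ExponentialFields.isSemialgebraic_univ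
  have h := isSemialgebraic_sep_eq (soloInformed_isSemialgebraicFunOn_aevalK hK hu Q)
    (isSemialgebraicFunOn_natCast hu 0)
  simpa using h

/-- Points of a finite `ℚ`-semialgebraic set have coordinates in any real-root-closed
`K ⊆ ℚ̄ ∩ ℝ`. -/
theorem soloInformed_exists_coordsK_of_finite {n : ℕ} (hKrc : SoloInformedRealRootClosed K)
    {Z : Set (Fin n → ℝ)} (hZ : IsSemialgebraic ℚ Z) (hfin : Z.Finite) {z : Fin n → ℝ}
    (hz : z ∈ Z) : ∃ c : Fin n → K, (fun i => algebraMap K ℝ (c i)) = z := by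
  choose c hc using fun i =>
    soloInformed_exists_algebraMap_eq_of_isAlgebraic hKrc
      (soloInformed_isAlgebraic_apply_of_finite hZ hfin hz i)
  exact ⟨c, funext hc⟩

/-- **The special set** `Σ(F, D, Ω)`: points of `closure Ω ∩ Z(F)` where `Z(F)` is singular
or `D` vanishes. [this work] -/
def soloInformedSpecialSet (F D : MvPolynomial (Fin 2) K) (Ω : Set (Fin 2 → ℝ)) :
    Set (Fin 2 → ℝ) :=
  {w | w ∈ closure Ω ∧ (MvPolynomial.aeval w F : ℝ) = 0 ∧
    (((MvPolynomial.aeval w (MvPolynomial.pderiv 0 F) : ℝ) = 0 ∧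
      (MvPolynomial.aeval w (MvPolynomial.pderiv 1 F) : ℝ) = 0) ∨
      (MvPolynomial.aeval w D : ℝ) = 0)}

/-- Membership in the special set. -/
theorem soloInformed_mem_specialSet (F D : MvPolynomial (Fin 2) K) (Ω : Set (Fin 2 → ℝ))
    (w : Fin 2 → ℝ) :
    w ∈ soloInformedSpecialSet F D Ω ↔ w ∈ closure Ω ∧ (MvPolynomial.aeval w F : ℝ) = 0 ∧
      (((MvPolynomial.aeval w (MvPolynomial.pderiv 0 F) : ℝ) = 0 ∧
        (MvPolynomial.aeval w (MvPolynomial.pderiv 1 F) : ℝ) = 0) ∨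
        (MvPolynomial.aeval w D : ℝ) = 0) := Iff.rfl

/-- Off the special set, a point of `closure Ω ∩ Z(F)` is a smooth point of `Z(F)` with
`D ≠ 0`. -/
theorem soloInformed_good_of_not_mem_specialSet {F D : MvPolynomial (Fin 2) K}
    {Ω : Set (Fin 2 → ℝ)} {w : Fin 2 → ℝ} (hw : w ∉ soloInformedSpecialSet F D Ω)
    (hcl : w ∈ closure Ω) (hF : (MvPolynomial.aeval w F : ℝ) = 0) :
    ((MvPolynomial.aeval w (MvPolynomial.pderiv 0 F) : ℝ) ≠ 0 ∨
      (MvPolynomial.aeval w (MvPolynomial.pderiv 1 F) : ℝ) ≠ 0) ∧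
      (MvPolynomial.aeval w D : ℝ) ≠ 0 := by
  rw [soloInformed_mem_specialSet] at hw
  push Not at hw
  obtain ⟨hgrad, hD⟩ := hw hcl hF
  refine ⟨?_, hD⟩
  by_cases h0 : (MvPolynomial.aeval w (MvPolynomial.pderiv 0 F) : ℝ) = 0
  · exact Or.inr (hgrad h0)
  · exact Or.inl h0

/-- The special set is `ℚ`-semialgebraic. -/
theorem soloInformed_isSemialgebraic_specialSet
    (hK : ∀ c : K, IsAlgebraic ℚ (algebraMap K ℝ c)) (F D : MvPolynomial (Fin 2) K)
    {Ω : Set (Fin 2 → ℝ)} (hΩ : IsSemialgebraic ℚ Ω) :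
    IsSemialgebraic ℚ (soloInformedSpecialSet F D Ω) := by
  have h := (Literature.ModelTheory.ExponentialFields.isSemialgebraic_closure hΩ).inter
    ((soloInformed_isSemialgebraic_zeroSetK_univ hK F).inter
      (((soloInformed_isSemialgebraic_zeroSetK_univ hK (MvPolynomial.pderiv 0 F)).inter
        (soloInformed_isSemialgebraic_zeroSetK_univ hK (MvPolynomial.pderiv 1 F))).union
        (soloInformed_isSemialgebraic_zeroSetK_univ hK D)))
  convert h using 1
  exact Set.ext fun w => Iff.rfl

/-- The special set is finite when the singular set of `F` and the polar set of `D` on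
`closure Ω` are. -/
theorem soloInformed_specialSet_finite {F D : MvPolynomial (Fin 2) K} {Ω : Set (Fin 2 → ℝ)}
    (hsing : (soloInformedSingSet F).Finite)
    (hpol : ({z : Fin 2 → ℝ | (MvPolynomial.aeval z D : ℝ) = 0} ∩ closure Ω).Finite) :
    (soloInformedSpecialSet F D Ω).Finite := by
  refine ((soloInformed_singPts_finite_of_singSet hsing).union hpol).subset fun w hw => ?_
  obtain ⟨hcl, hF, h | h⟩ := hw
  · exact Or.inl ⟨hF, h⟩
  · exact Or.inr ⟨h, hcl⟩

/-- Hence its points have coordinates in `K`. -/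
theorem soloInformed_exists_coordsK_of_mem_specialSet
    (hK : ∀ c : K, IsAlgebraic ℚ (algebraMap K ℝ c)) (hKrc : SoloInformedRealRootClosed K)
    {F D : MvPolynomial (Fin 2) K} {Ω : Set (Fin 2 → ℝ)} (hΩ : IsSemialgebraic ℚ Ω)
    (hfin : (soloInformedSpecialSet F D Ω).Finite) {w : Fin 2 → ℝ}
    (hw : w ∈ soloInformedSpecialSet F D Ω) :
    ∃ c : Fin 2 → K, (fun i => algebraMap K ℝ (c i)) = w :=
  soloInformed_exists_coordsK_of_finite hKrc (soloInformed_isSemialgebraic_specialSet hK F D hΩ)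
    hfin hw

end Summit.KontsevichZagierPeriods.KontsevichZagierPeriods.Theorems
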